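import Summits.CriticalPhenomena.PercolationContinuityZ3.Theses.PercBudgetLadder
import Summits.CriticalPhenomena.PercolationContinuityZ3.Theses.PercNonProliferation
import Summits.CriticalPhenomena.PercolationContinuityZ3.Theorems.DefectDimension.Negative.AllOpenCutsets
import Literature.Probability.Percolation.MinOpenCut
import Literature.Probability.Percolation.PercolationEvents

/-!
# Line `talagrand-window-amplifier` — checked skeleton for the crux `DefectDimension`
# (stmt-CriticalPhenomena-5250, route `PercBudgetLadder`, rung r4)

Crux (fixed, by name): `PercBudgetLadder.DefectDimension` —
`∃ c > 0, P_{p_c(ℤ³)}(MinCut(n,2n) ≤ n^{2-c}) → 1`, where `MinCut(n,2n)(ω)` is the min-cut budget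
`minOpenCutIn B(2n) B(n) ∂ⁱⁿB(2n) ω` of the annulus (`minOpenCutIn_le_iff` is verbatim the crux's
event).

THE LINE (idea card `Ideas/talagrand-window-amplifier.md`, triage r1-1/2/3 all `pass`; sharpened as
the panel asked: "the LINE is A1 + `defectDimension_of_rare`", window feeder A3 parked).
`MinCut(n,2n)` is a LOCAL (reads only the `≤ 6(4n+1)³` lattice edges of `B(2n)`) and 1-LIPSCHITZ
(flipping one edge moves it by at most one) function of independent Bernoulli edges, so
Talagrand's / McDiarmid's concentration inequality makes typical and moderately-rare behaviour of the
critical min-cut coincide down to depth `exp(-n^β)`, `β < 1`: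

* `stub_concentration` (A1, KNOWN — Talagrand 1995 Thm 4.1.1 / McDiarmid 1989 bounded differences,
  to be vendored for `bondPercolation = setBer(E(ℤ³), p)`, in the conventions of the tree's
  `bondPercolation_variance_le_of_bounded_differences`): for every finite edge set `F ⊆ E(ℤ³)` and
  every measurable `f : BondConfig → ℝ` determined by `F` with bounded differences `1`:
  `P_p(f ≤ s) · P_p(f ≥ s + t) ≤ exp(-t² / (4 #F))`, `t ≥ 0` (McDiarmid even gives `exp(-t²/#F)`).
* `stub_rareCheapCut` (the transfer target C⁺ = `RareCheapCut`, OPEN, the hardest stub):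
  `∃ c > 0, β < 1, eventually exp(-n^β) ≤ P_{p_c}(MinCut(n,2n) ≤ ⌊n^{2-c}⌋₊)` — a LOWER-TAIL
  large-deviation bound for the critical min-cut (necessary for the crux trivially; sufficient by
  this file).
* `DefectDimension_of : Stubs.stub_concentration → Stubs.stub_rareCheapCut → DefectDimension`
  (the stub `Prop`s by name), PROVED here
  (no `sorry`; axioms `propext, Classical.choice, Quot.sound`): locality
  (`determinedBy_setOf_minOpenCutIn_le`), finiteness and the Lipschitz property of `MinCut` under
  edge insertion, measurability, the a.s.-lattice reading (`setBernoulli_ae_subset`), the count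
  `#edgesIn(B(2n)) ≤ 6(4n+1)³`, and the arithmetic `k = ⌊n^{2-c}⌋₊`, `t = ⌈n^θ⌉₊ + 1`,
  `θ = (7+β')/4`, `β' = max β ½`, `c' = (2 - max(2-c, θ))/2`,
  `P(MinCut ≥ k + t) ≤ exp(n^{β'} - n^{(1+β')/2}/3000) → 0`.
* `DefectDimension_proof : DefectDimension := DefectDimension_of stub_concentration stub_rareCheapCut`
  — the skeleton IS the crux proof once the two sorries are discharged (D-0027 §3.3).
* Proved extras: `rareCheapCut_of_defectDimension` (the crux implies stub 2: modulo the KNOWN stub 1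
  the two are EQUIVALENT — the stub loses nothing), `rareCheapCut_of_subexponentialBlocking` (card
  feeder A4 ⟹ stub 2), `rareCheapCut_of_subpolynomialBlocking` (cross-route glue: stmt-4446 ⟹ stub 2).

Disproof.lean (cdisprove v2) honoured: no `_false_without_` theorem exists; §2.4 / landed
`Negative.AllOpenCutsets` (no FIXED cutset is sub-areal, `p = 1` false) — the line never names a
cutset and `stub_rareCheapCut` is stated AT `p_c` (false at `p = 1` exactly like the crux, true
below `p_c` like the crux: `Negative.Subcritical`), so it is not an instance of a refuted
strengthening; §3 `saving_le_two` — the line yields `c' < 1/2 ≤ 2`; §4 consistent.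
-/

noncomputable section

open MeasureTheory ProbabilityTheory Filter
open Literature.Probability.Percolation Literature.Probability.LatticeModels
open Summit.CriticalPhenomena.PercolationContinuityZ3.Theorems.DefectDimension.Negative
open scoped Topology

namespace Summit.CriticalPhenomena.PercolationContinuityZ3.Cruxes.DefectDimension.TalagrandWindowAmplifier

/-! ## The two registered stubs: precise `Prop`s `Stubs.stub_*` + sorried theorems `stub_*`

D-0027 §3.3 shape: `DefectDimension_of : Stubs.stub_concentration → Stubs.stub_rareCheapCut →
DefectDimension` (hypotheses = the declared stub `Prop`s, BY NAME), `stub_concentration :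
<Stubs.stub_concentration spelled out> := by sorry`, `stub_rareCheapCut : <Stubs.stub_rareCheapCut
spelled out> := by sorry` (the registered stubs; their signatures are self-contained over tree
declarations), and `DefectDimension_proof : DefectDimension := DefectDimension_of stub_concentration
stub_rareCheapCut` (the skeleton IS the crux proof once both sorries are discharged; the application
type-checks by unfolding, so the spelled-out signatures cannot drift from the `Prop`s). -/

namespace Stubs

/-- **Stub `Prop` 1 (`ConcentrationInequality`) — concentration for local Lipschitz observables of
bond percolation on `ℤ³`** (KNOWN: Talagrand 1995 Thm 4.1.1 / McDiarmid 1989; to vendor). Spelled out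
and sorried as `stub_concentration` below. -/
def stub_concentration : Prop :=
  ∀ (p : unitInterval) (F : Finset (Sym2 (Site 3))),
    (↑F : Set (Sym2 (Site 3))) ⊆ (zdGraph 3).edgeSet →
    ∀ (f : BondConfig (Site 3) → ℝ), Measurable f →
    (∀ ω, f ω = f (ω ∩ ↑F)) →
    (∀ ω, ∀ e ∈ F, e ∉ ω → |f (insert e ω) - f ω| ≤ 1) →
    ∀ s t : ℝ, 0 ≤ t →
      (bondPercolation (zdGraph 3) p).real {ω | f ω ≤ s} *
          (bondPercolation (zdGraph 3) p).real {ω | s + t ≤ f ω} ≤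
        Real.exp (-(t ^ 2) / (4 * (F.card : ℝ)))

/-- **Stub `Prop` 2 (`RareCheapCut`) — the transfer target C⁺** (OPEN; the hardest stub). Spelled
out and sorried as `stub_rareCheapCut` below. -/
def stub_rareCheapCut : Prop :=
  ∃ c β : ℝ, 0 < c ∧ β < 1 ∧ ∀ᶠ n : ℕ in atTop,
    Real.exp (-((n : ℝ) ^ β)) ≤
      (bondPercolation (zdGraph 3) (criticalProbI 3)).real
        {ω | minOpenCutIn (↑(box 3 (2 * n)) : Set (Site 3)) ↑(box 3 n)
            ↑(innerBoundary (zdGraph 3) (box 3 (2 * n))) ω ≤ ⌊(n : ℝ) ^ (2 - c)⌋₊}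

end Stubs

/-- **stub 1 (registered) = `Stubs.stub_concentration` (ConcentrationInequality) spelled out — concentration for local Lipschitz
observables of bond percolation on `ℤ³`**
(Talagrand 1995, *Concentration of measure and isoperimetric inequalities in product spaces*,
Publ. IHÉS 81, Thm 4.1.1 with `d_T ≥ d_H/√N`; or McDiarmid 1989 bounded differences, which gives
the product form with the better constant `exp(-t²/#F)` by a three-case argument on the position of
the mean). KNOWN, to vendor; size L (Doob martingale + Azuma–Hoeffding, or Talagrand's induction).
Stated in the conventions of the tree's Efron–Stein transport
`Literature.Probability.Percolation.bondPercolation_variance_le_of_bounded_differences` (same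
hypotheses, exponential instead of second-moment conclusion): for `P_p = bondPercolation (zdGraph 3) p
= setBer(E(ℤ³), p)`, a finite set `F ⊆ E(ℤ³)` of edges, and a measurable `f : BondConfig → ℝ`
determined by `F` (`f ω = f (ω ∩ F)`) with bounded differences `|f (ω ∪ {e}) - f ω| ≤ 1`
(`e ∈ F` closed in `ω`): `P_p(f ≤ s) · P_p(s + t ≤ f) ≤ exp(-t²/(4 #F))` for every `s` and `t ≥ 0`. -/
theorem stub_concentration :
    ∀ (p : unitInterval) (F : Finset (Sym2 (Site 3))),
      (↑F : Set (Sym2 (Site 3))) ⊆ (zdGraph 3).edgeSet →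
      ∀ (f : BondConfig (Site 3) → ℝ), Measurable f →
      (∀ ω, f ω = f (ω ∩ ↑F)) →
      (∀ ω, ∀ e ∈ F, e ∉ ω → |f (insert e ω) - f ω| ≤ 1) →
      ∀ s t : ℝ, 0 ≤ t →
        (bondPercolation (zdGraph 3) p).real {ω | f ω ≤ s} *
            (bondPercolation (zdGraph 3) p).real {ω | s + t ≤ f ω} ≤
          Real.exp (-(t ^ 2) / (4 * (F.card : ℝ))) := by
  sorry

/-- **stub 2 (registered) = `Stubs.stub_rareCheapCut` (RareCheapCut) spelled out — the transfer target C⁺ (OPEN; the hardest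
stub)**: a
stretched-exponential LOWER bound for the lower tail of the critical min-cut — for some saving
`c > 0` and some `β < 1`, eventually `P_{p_c}(MinCut(n,2n) ≤ ⌊n^{2-c}⌋₊) ≥ exp(-n^β)`.
Necessary for the crux (`rareCheapCut_of_defectDimension` below, proved); sufficient by
`DefectDimension_of`. Feeders (line card): critical blocking `P_{p_c}(A(n,2n) blocked) ≥ exp(-n^β)`
(card A4; `rareCheapCut_of_subexponentialBlocking` below, proved); a RATE —
`PercLowPointHalfSpace.QuantitativeBGN` (support 5252) or a polynomial subcritical window priced by the
discounted-cut exchange (card A3, parked by triage). At CONSTANT depth (probability `≥ δ`) the crux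
already follows from the tree's PROVED Efron–Stein bound
`bondPercolation_variance_le_of_bounded_differences` + Chebyshev; this stub is the strictly deeper
`exp(-n^β)` form. Why it might fail / be hard: every rigorous lower bound for critical blocking-type
events in `d = 3` is an FKG product over half-space arms, `exp(-C n² π_H(n)) = exp(-n^{1.025})` even
with the physical exponent — depth `β < 1` needs a non-product construction or a rate. -/
theorem stub_rareCheapCut :
    ∃ c β : ℝ, 0 < c ∧ β < 1 ∧ ∀ᶠ n : ℕ in atTop,
      Real.exp (-((n : ℝ) ^ β)) ≤
        (bondPercolation (zdGraph 3) (criticalProbI 3)).real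
          {ω | minOpenCutIn (↑(box 3 (2 * n)) : Set (Site 3)) ↑(box 3 n)
              ↑(innerBoundary (zdGraph 3) (box 3 (2 * n))) ω ≤ ⌊(n : ℝ) ^ (2 - c)⌋₊} := by
  sorry

/-! ## Proved infrastructure: `MinCut(n,2n)` is a finite, local, 1-Lipschitz lattice observable -/

/-- The region `B(2n)`. -/
abbrev annS (n : ℕ) : Set (Site 3) := ↑(box 3 (2 * n))
/-- The sources `B(n)`. -/
abbrev annA (n : ℕ) : Set (Site 3) := ↑(box 3 n)
/-- The sinks `∂ⁱⁿB(2n)`. -/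
abbrev annB (n : ℕ) : Set (Site 3) := ↑(innerBoundary (zdGraph 3) (box 3 (2 * n)))
/-- `MinCut(n,2n)(ω)`. -/
abbrev annMinCut (n : ℕ) (ω : BondConfig (Site 3)) : ℕ∞ := minOpenCutIn (annS n) (annA n) (annB n) ω

/-- Closing every pair inside `B(2n)` blocks the annulus (`n ≥ 1`): `MinCut(n,2n) ≤ #Sym2(B(2n)) < ⊤`
for EVERY configuration (lattice or not). -/
theorem annMinCut_le_card_sym2 {n : ℕ} (hn : 1 ≤ n) (ω : BondConfig (Site 3)) :
    annMinCut n ω ≤ (((box 3 (2 * n)).sym2.card : ℕ) : ℕ∞) := by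
  apply minOpenCutIn_le_card
  intro x hx y hy hconn
  obtain ⟨hxS, hyS, hr⟩ := hconn
  have hle : (openGraph (ω \ ↑((box 3 (2 * n)).sym2))).induce (annS n) ≤ ⊥ := by
    intro a b hab
    rw [SimpleGraph.induce_adj, openGraph_adj] at hab
    obtain ⟨⟨-, hnot⟩, -⟩ := hab
    apply hnot
    rw [Finset.coe_sym2]
    exact Set.mk_mem_sym2_iff.2 ⟨a.2, b.2⟩
  have hxy := hr.mono hle
  rw [SimpleGraph.reachable_bot] at hxy
  have hxy' : x = y := congrArg Subtype.val hxy
  exact notMem_box_of_mem_innerBoundary hn hy (hxy' ▸ hx)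

theorem annMinCut_ne_top {n : ℕ} (hn : 1 ≤ n) (ω : BondConfig (Site 3)) : annMinCut n ω ≠ ⊤ :=
  ne_top_of_le_ne_top (ENat.coe_ne_top _) (annMinCut_le_card_sym2 hn ω)

/-- **1-Lipschitz under opening an edge**: `MinCut(ω ∪ {e}) ≤ MinCut(ω) + 1` (an optimal cutset `T`
of `ω` gives the cutset `T ∪ {e}` of `ω ∪ {e}`). -/
theorem annMinCut_insert_le (n : ℕ) (ω : BondConfig (Site 3)) (e : Sym2 (Site 3)) :
    annMinCut n (insert e ω) ≤ annMinCut n ω + 1 := by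
  classical
  by_cases htop : annMinCut n ω = ⊤
  · rw [htop, top_add]; exact le_top
  obtain ⟨T, hT, hcard⟩ := exists_eq_minOpenCutIn htop
  have hset : insert e ω \ (↑(insert e T) : Set (Sym2 (Site 3))) = ω \ ↑(insert e T) := by
    ext x
    simp only [Set.mem_sdiff, Set.mem_insert_iff, Finset.coe_insert]
    tauto
  have hT' : IsOpenCutsetIn (annS n) (annA n) (annB n) ω ↑(insert e T) :=
    hT.mono (Finset.coe_subset.2 (Finset.subset_insert e T))
  have hcut : IsOpenCutsetIn (annS n) (annA n) (annB n) (insert e ω) ↑(insert e T) := by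
    intro x hx y hy
    rw [hset]
    exact hT' x hx y hy
  calc annMinCut n (insert e ω) ≤ ((insert e T).card : ℕ∞) := minOpenCutIn_le_card hcut
    _ ≤ ((T.card + 1 : ℕ) : ℕ∞) := by exact_mod_cast Finset.card_insert_le e T
    _ = annMinCut n ω + 1 := by push_cast; rw [hcard]

private theorem enat_eq_of_forall_le_iff {a b : ℕ∞} (h : ∀ k : ℕ, a ≤ k ↔ b ≤ k) : a = b := by
  apply le_antisymm
  · induction b using ENat.recTopCoe with
    | top => exact le_top
    | coe m => exact (h m).2 le_rfl
  · induction a using ENat.recTopCoe with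
    | top => exact le_top
    | coe m => exact (h m).1 le_rfl

/-- **Locality**: `MinCut(n,2n)` reads only the pairs inside `B(2n)`
(`determinedBy_setOf_minOpenCutIn_le`). -/
theorem annMinCut_inter_sym2 (n : ℕ) (ω : BondConfig (Site 3)) :
    annMinCut n (ω ∩ (annS n).sym2) = annMinCut n ω := by
  apply enat_eq_of_forall_le_iff
  intro k
  have h := (determinedBy_iff _ _).1
    (determinedBy_setOf_minOpenCutIn_le (annS n) (annA n) (annB n) k)
    (ω ∩ (annS n).sym2) ω (by rw [Set.inter_assoc, Set.inter_self])
  simpa using h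

/-- The live pairs inside `B(2n)` are the lattice edges of the box. -/
theorem sym2_inter_edgeSet_subset (n : ℕ) :
    (annS n).sym2 ∩ (zdGraph 3).edgeSet ⊆ ↑(edgesIn (zdGraph 3) (box 3 (2 * n))) := by
  rintro e ⟨he, heE⟩
  rw [Finset.mem_coe, mem_edgesIn_iff]
  refine ⟨heE, ?_⟩
  revert he
  induction e using Sym2.ind with
  | h a b =>
    intro he x hx
    rw [Set.mk_mem_sym2_iff] at he
    rcases Sym2.mem_iff.1 hx with rfl | rfl
    · exact he.1
    · exact he.2

/-- Conversely the lattice edges of the box are pairs inside the box, and lattice edges. -/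
theorem coe_edgesIn_subset_sym2 (n : ℕ) :
    (↑(edgesIn (zdGraph 3) (box 3 (2 * n))) : Set (Sym2 (Site 3))) ⊆ (annS n).sym2 := by
  intro e he
  have h := (mem_edgesIn_iff.1 (Finset.mem_coe.1 he)).2
  revert h
  induction e using Sym2.ind with
  | h a b =>
    intro h
    exact Set.mk_mem_sym2_iff.2 ⟨h a (Sym2.mem_mk_left a b), h b (Sym2.mem_mk_right a b)⟩

theorem coe_edgesIn_subset_edgeSet (n : ℕ) :
    (↑(edgesIn (zdGraph 3) (box 3 (2 * n))) : Set (Sym2 (Site 3))) ⊆ (zdGraph 3).edgeSet :=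
  fun _ he => (mem_edgesIn_iff.1 (Finset.mem_coe.1 he)).1

/-- On lattice configurations, reading `MinCut(n,2n)` through the lattice edges of the box is exact. -/
theorem annMinCut_inter_edgesIn {n : ℕ} {ω : BondConfig (Site 3)} (hω : ω ⊆ (zdGraph 3).edgeSet) :
    annMinCut n (ω ∩ ↑(edgesIn (zdGraph 3) (box 3 (2 * n)))) = annMinCut n ω := by
  rw [← annMinCut_inter_sym2 n ω]
  congr 1
  apply Set.Subset.antisymm
  · exact Set.inter_subset_inter_right _ (coe_edgesIn_subset_sym2 n)
  · rintro e ⟨heω, hes⟩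
    exact ⟨heω, sym2_inter_edgeSet_subset n ⟨hes, hω heω⟩⟩

/-- `#edgesIn(B(2n)) ≤ 6 (4n+1)³` (each of the `(4n+1)³` sites has `6` incident edges). -/
theorem card_edgesIn_box_le (n : ℕ) :
    (edgesIn (zdGraph 3) (box 3 (2 * n))).card ≤ 6 * (4 * n + 1) ^ 3 := by
  classical
  calc (edgesIn (zdGraph 3) (box 3 (2 * n))).card
      ≤ (edgesTouching (zdGraph 3) (box 3 (2 * n))).card :=
        Finset.card_le_card (edgesIn_subset_edgesTouching _)
    _ ≤ ∑ x ∈ box 3 (2 * n), ((zdGraph 3).incidenceFinset x).card := by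
        unfold edgesTouching
        exact Finset.card_biUnion_le
    _ = ∑ x ∈ box 3 (2 * n), 6 := Finset.sum_congr rfl (fun x _ => by
        rw [SimpleGraph.card_incidenceFinset_eq_degree, ← SimpleGraph.card_neighborFinset_eq_degree,
          card_neighborFinset_zdGraph_holds x])
    _ = 6 * (4 * n + 1) ^ 3 := by
        rw [Finset.sum_const, card_box, smul_eq_mul]
        ring

/-- There is at least one lattice edge inside `B(2n)` (`n ≥ 1`). -/
theorem card_edgesIn_box_pos {n : ℕ} (hn : 1 ≤ n) :
    0 < (edgesIn (zdGraph 3) (box 3 (2 * n))).card := by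
  classical
  apply Finset.card_pos.2
  refine ⟨s((0 : Site 3), Pi.single 0 1), ?_⟩
  rw [mem_edgesIn_iff]
  refine ⟨?_, ?_⟩
  · rw [SimpleGraph.mem_edgeSet]
    exact (zdGraph_adj_iff _ _).2 ⟨0, Or.inl (by simp)⟩
  · intro x hx
    rcases Sym2.mem_iff.1 hx with rfl | rfl
    · exact zero_mem_box 3 _
    · rw [mem_box]
      intro i
      by_cases hi : i = 0
      · subst hi; simp; omega
      · simp [hi]

/-! ## No loss: the crux implies `RareCheapCut` (so, given stub 1, the two are EQUIVALENT) -/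

/-- **Necessity.** `DefectDimension → RareCheapCut` (same saving `c`, `β = 1/2`): probability `→ 1`
is eventually `> 1/2 ≥ exp(-n^{1/2})`, and for natural `#S` the real budget `n^{2-c}` is the natural
budget `⌊n^{2-c}⌋₊`. Hence `stub_rareCheapCut` loses nothing: modulo the KNOWN `stub_concentration`
it is a reformulation of the crux as a lower-tail large-deviation bound at depth `exp(-n^β)`. -/
theorem rareCheapCut_of_defectDimension
    (h : Summit.CriticalPhenomena.PercolationContinuityZ3.Theses.PercBudgetLadder.DefectDimension) :
    Stubs.stub_rareCheapCut := by
  obtain ⟨c, hc, hT⟩ := h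
  refine ⟨c, 1 / 2, hc, by norm_num, ?_⟩
  have hev := hT.eventually (lt_mem_nhds (by norm_num : (1 / 2 : ℝ) < 1))
  filter_upwards [hev, eventually_ge_atTop 1] with n hn hn1
  have hnR : (1 : ℝ) ≤ n := by exact_mod_cast hn1
  have hset : {ω : BondConfig (Site 3) | ∃ S : Finset (Sym2 (Site 3)),
      (S.card : ℝ) ≤ (n : ℝ) ^ (2 - c) ∧
        ¬ ∃ x ∈ box 3 n, ∃ y ∈ innerBoundary (zdGraph 3) (box 3 (2 * n)),
          (ω \ ↑S) ∈ openConnIn (↑(box 3 (2 * n)) : Set (Site 3)) x y} =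
      {ω | minOpenCutIn (↑(box 3 (2 * n)) : Set (Site 3)) ↑(box 3 n)
          ↑(innerBoundary (zdGraph 3) (box 3 (2 * n))) ω ≤ ⌊(n : ℝ) ^ (2 - c)⌋₊} := by
    ext ω
    rw [Set.mem_setOf_eq, Set.mem_setOf_eq, minOpenCutIn_le_iff]
    constructor
    · rintro ⟨S, hS, hnot⟩
      exact ⟨S, Nat.le_floor hS, hnot⟩
    · rintro ⟨T, hTk, hnot⟩
      exact ⟨T, (by exact_mod_cast hTk : (T.card : ℝ) ≤ (⌊(n : ℝ) ^ (2 - c)⌋₊ : ℝ)).trans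
        (Nat.floor_le (Real.rpow_nonneg (by linarith) _)), hnot⟩
  rw [hset] at hn
  have h1 : Real.exp (-((n : ℝ) ^ (1 / 2 : ℝ))) ≤ Real.exp (-1) := by
    rw [Real.exp_le_exp, neg_le_neg_iff]
    exact Real.one_le_rpow hnR (by norm_num)
  have h2 : Real.exp (-1) ≤ 1 / 2 := by
    rw [Real.exp_neg, one_div]
    exact inv_anti₀ (by norm_num) (by linarith [Real.add_one_le_exp (1 : ℝ)])
  linarith

/-- **Card A4 feeds stub 2.** A stretched-exponential lower bound for critical BLOCKING
(`MinCut(n,2n) = 0`, i.e. no open crossing at all, `minOpenCutIn_eq_zero_iff`) gives `RareCheapCut`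
with every saving, here `c = 1` (budget `0 ≤ ⌊n⌋₊`). So `SubexponentialBlocking → DefectDimension`
is `DefectDimension_of hconc (rareCheapCut_of_subexponentialBlocking h)`. -/
theorem rareCheapCut_of_subexponentialBlocking
    (h : ∃ β : ℝ, β < 1 ∧ ∀ᶠ n : ℕ in atTop,
      Real.exp (-((n : ℝ) ^ β)) ≤
        (bondPercolation (zdGraph 3) (criticalProbI 3)).real
          {ω | minOpenCutIn (↑(box 3 (2 * n)) : Set (Site 3)) ↑(box 3 n)
              ↑(innerBoundary (zdGraph 3) (box 3 (2 * n))) ω = 0}) :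
    Stubs.stub_rareCheapCut := by
  obtain ⟨β, hβ, hev⟩ := h
  refine ⟨1, β, one_pos, hβ, ?_⟩
  filter_upwards [hev] with n hn
  refine hn.trans (measureReal_mono ?_)
  intro ω hω
  rw [Set.mem_setOf_eq] at hω ⊢
  rw [hω]
  exact zero_le

/-- **Cross-route glue: `PercNonProliferation.SubpolynomialBlocking` (stmt-CriticalPhenomena-4446) feeds
stub 2** (`n^{-1/2} ≥ exp(-n^{1/2})`, and blocked = `MinCut = 0` by `minOpenCutIn_eq_zero_iff`). Hence
4446 ⟹ 5250 given the known stub 1 (the Menger + BK route of card `bk-maxflow-squeeze` gives this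
glue unconditionally; recorded here to place stub 2 below 4446 and below `PercAnnulusCrossing`'s X_B). -/
theorem rareCheapCut_of_subpolynomialBlocking
    (h : Summit.CriticalPhenomena.PercolationContinuityZ3.Theses.PercNonProliferation.SubpolynomialBlocking) :
    Stubs.stub_rareCheapCut := by
  apply rareCheapCut_of_subexponentialBlocking
  refine ⟨1 / 2, by norm_num, ?_⟩
  have hev := h (1 / 2) (by norm_num)
  filter_upwards [hev, eventually_ge_atTop 1] with n hn hn1
  have hnpos : (0 : ℝ) < n := by exact_mod_cast hn1
  have hset : {ω : BondConfig (Site 3) | ¬ ∃ x ∈ box 3 n,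
      ∃ y ∈ innerBoundary (zdGraph 3) (box 3 (2 * n)),
        ω ∈ openConnIn (↑(box 3 (2 * n)) : Set (Site 3)) x y} =
      {ω | minOpenCutIn (↑(box 3 (2 * n)) : Set (Site 3)) ↑(box 3 n)
          ↑(innerBoundary (zdGraph 3) (box 3 (2 * n))) ω = 0} := by
    ext ω
    simp only [Set.mem_setOf_eq, minOpenCutIn_eq_zero_iff, not_exists, not_and, Finset.mem_coe]
  rw [hset] at hn
  refine le_trans ?_ hn
  have hr : (n : ℝ) ^ (-(1 / 2 : ℝ)) = Real.exp (Real.log n * (-(1 / 2 : ℝ))) :=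
    Real.rpow_def_of_pos hnpos _
  rw [hr, Real.exp_le_exp]
  have hlog := Real.log_le_rpow_div hnpos.le (by norm_num : (0 : ℝ) < 1 / 2)
  linarith [hlog]

/-! ## The composition -/

/-- **`DefectDimension` from the two stub `Prop`s** (kernel-checked, no `sorry`; concludes the crux BY
NAME; hypotheses are exactly the declared stubs `Stubs.stub_concentration` (= `ConcentrationInequality`)
and `Stubs.stub_rareCheapCut` (= `RareCheapCut`), BY NAME). -/
theorem DefectDimension_of (hconc : Stubs.stub_concentration) (hrare : Stubs.stub_rareCheapCut) :
    Summit.CriticalPhenomena.PercolationContinuityZ3.Theses.PercBudgetLadder.DefectDimension := by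
  classical
  unfold Stubs.stub_concentration at hconc
  unfold Stubs.stub_rareCheapCut at hrare
  obtain ⟨c, β, hc, hβ, hfloor⟩ := hrare
  /- parameters -/
  set β' : ℝ := max β (1 / 2) with hβ'def
  have hβ'lt : β' < 1 := max_lt hβ (by norm_num)
  have hβ'ge : (1 / 2 : ℝ) ≤ β' := le_max_right _ _
  have hββ' : β ≤ β' := le_max_left _ _
  have hβ'pos : 0 < β' := by linarith
  set θ : ℝ := (7 + β') / 4 with hθdef
  have hθlt : θ < 2 := by rw [hθdef]; linarith
  have hθge : (15 / 8 : ℝ) ≤ θ := by rw [hθdef]; linarith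
  set γ : ℝ := (1 + β') / 2 with hγdef
  have hθγ : θ * 2 = γ + 3 := by rw [hθdef, hγdef]; ring
  have hγβ : β' < γ := by rw [hγdef]; linarith
  have hγpos : 0 < γ := by linarith
  set a : ℝ := max (2 - c) θ with hadef
  have halt : a < 2 := max_lt (by linarith) hθlt
  have haθ : θ ≤ a := le_max_right _ _
  have hac : 2 - c ≤ a := le_max_left _ _
  have hapos : 0 < a := by linarith
  set c' : ℝ := (2 - a) / 2 with hc'def
  have hc'pos : 0 < c' := by rw [hc'def]; linarith
  have hbudget : 2 - c' = a + c' := by rw [hc'def]; ring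
  refine ⟨c', hc'pos, ?_⟩
  /- notation -/
  set P : Measure (BondConfig (Site 3)) := bondPercolation (zdGraph 3) (criticalProbI 3) with hPdef
  let kk : ℕ → ℕ := fun n => ⌊(n : ℝ) ^ (2 - c)⌋₊
  let tt : ℕ → ℕ := fun n => ⌈(n : ℝ) ^ θ⌉₊
  let ε : ℕ → ℝ := fun n => Real.exp ((n : ℝ) ^ β' - (n : ℝ) ^ γ / 3000)
  /- the crux's event contains `{MinCut ≤ kk n + tt n}` once `kk n + tt n ≤ n^{2-c'}` -/
  have hevent : ∀ n : ℕ, ((kk n + tt n : ℕ) : ℝ) ≤ (n : ℝ) ^ (2 - c') →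
      {ω | annMinCut n ω ≤ (kk n + tt n : ℕ)} ⊆
        {ω | ∃ S : Finset (Sym2 (Site 3)), (S.card : ℝ) ≤ (n : ℝ) ^ (2 - c') ∧
          ¬ ∃ x ∈ box 3 n, ∃ y ∈ innerBoundary (zdGraph 3) (box 3 (2 * n)),
            (ω \ ↑S) ∈ openConnIn (↑(box 3 (2 * n)) : Set (Site 3)) x y} := by
    intro n hle ω hω
    rw [Set.mem_setOf_eq, minOpenCutIn_le_iff] at hω
    obtain ⟨T, hTk, hT⟩ := hω
    exact ⟨T, (by exact_mod_cast hTk : (T.card : ℝ) ≤ ((kk n + tt n : ℕ) : ℝ)).trans hle, hT⟩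
  /- MAIN ESTIMATE at a fixed scale `n ≥ 1` where the floor holds -/
  have hmain : ∀ n : ℕ, 1 ≤ n →
      Real.exp (-((n : ℝ) ^ β)) ≤ P.real {ω | annMinCut n ω ≤ kk n} →
      1 - ε n ≤ P.real {ω | annMinCut n ω ≤ (kk n + tt n : ℕ)} := by
    intro n hn hfl
    have hnR : (1 : ℝ) ≤ n := by exact_mod_cast hn
    have hnpos : (0 : ℝ) < n := by linarith
    -- the coordinates: lattice edges of the box
    set F : Finset (Sym2 (Site 3)) := edgesIn (zdGraph 3) (box 3 (2 * n)) with hFdef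
    have hFsub : (↑F : Set (Sym2 (Site 3))) ⊆ (zdGraph 3).edgeSet := coe_edgesIn_subset_edgeSet n
    -- the observable `g = MinCut(n,2n)` (finite) and its lattice reading `f ω = g (ω ∩ F)`
    set g : BondConfig (Site 3) → ℕ := fun ω => (annMinCut n ω).toNat with hgdef
    have hcoe : ∀ ω, (g ω : ℕ∞) = annMinCut n ω := fun ω => ENat.coe_toNat (annMinCut_ne_top hn ω)
    have hlevel : ∀ m : ℕ, {ω | g ω ≤ m} = {ω | annMinCut n ω ≤ m} := by
      intro m; ext ω
      simp only [Set.mem_setOf_eq, ← hcoe ω, Nat.cast_le]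
    have hmeas : ∀ m : ℕ, MeasurableSet {ω | annMinCut n ω ≤ m} := fun m =>
      measurableSet_setOf_minOpenCutIn_le (Finset.finite_toSet _) _ _ m
    have hgm : Measurable g := by
      refine measurable_to_countable' fun m => ?_
      rcases m with _ | m
      · have : g ⁻¹' {0} = {ω | annMinCut n ω ≤ (0 : ℕ)} := by
          rw [← hlevel 0]; ext ω
          simp only [Set.mem_preimage, Set.mem_singleton_iff, Set.mem_setOf_eq, Nat.le_zero]
        rw [this]; exact hmeas 0
      · have : g ⁻¹' {m + 1} = {ω | annMinCut n ω ≤ (m + 1 : ℕ)} \ {ω | annMinCut n ω ≤ m} := by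
          rw [← hlevel (m + 1), ← hlevel m]; ext ω
          simp only [Set.mem_preimage, Set.mem_singleton_iff, Set.mem_sdiff, Set.mem_setOf_eq]
          omega
        rw [this]; exact (hmeas _).diff (hmeas _)
    set f : BondConfig (Site 3) → ℝ := fun ω => (g (ω ∩ ↑F) : ℝ) with hfdef
    have hinter : Measurable fun ω : BondConfig (Site 3) => ω ∩ (↑F : Set (Sym2 (Site 3))) := by
      refine measurable_set_iff.2 fun e' => ?_
      simp only [Set.mem_inter_iff]
      exact (measurable_set_mem e').and measurable_const
    have hfm : Measurable f := measurable_from_nat.comp (hgm.comp hinter)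
    have hdet : ∀ ω, f ω = f (ω ∩ ↑F) := fun ω => by
      simp only [hfdef, Set.inter_assoc, Set.inter_self]
    have hc1 : ∀ ω, ∀ e ∈ F, e ∉ ω → |f (insert e ω) - f ω| ≤ 1 := by
      intro ω e he _
      have hins : insert e ω ∩ (↑F : Set (Sym2 (Site 3))) = insert e (ω ∩ ↑F) :=
        Set.insert_inter_of_mem (Finset.mem_coe.2 he)
      have h1 : annMinCut n (insert e (ω ∩ ↑F)) ≤ annMinCut n (ω ∩ ↑F) + 1 :=
        annMinCut_insert_le n (ω ∩ ↑F) e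
      have h2 : annMinCut n (ω ∩ ↑F) ≤ annMinCut n (insert e (ω ∩ ↑F)) :=
        minOpenCutIn_mono_config (Set.subset_insert e _)
      have h1' : g (insert e (ω ∩ ↑F)) ≤ g (ω ∩ ↑F) + 1 := by
        have : ((g (insert e (ω ∩ ↑F)) : ℕ) : ℕ∞) ≤ ((g (ω ∩ ↑F) + 1 : ℕ) : ℕ∞) := by
          push_cast; rw [hcoe, hcoe]; exact h1
        exact_mod_cast this
      have h2' : g (ω ∩ ↑F) ≤ g (insert e (ω ∩ ↑F)) := by
        have : ((g (ω ∩ ↑F) : ℕ) : ℕ∞) ≤ ((g (insert e (ω ∩ ↑F)) : ℕ) : ℕ∞) := by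
          rw [hcoe, hcoe]; exact h2
        exact_mod_cast this
      have h1R : (g (insert e (ω ∩ ↑F)) : ℝ) ≤ (g (ω ∩ ↑F) : ℝ) + 1 := by exact_mod_cast h1'
      have h2R : (g (ω ∩ ↑F) : ℝ) ≤ (g (insert e (ω ∩ ↑F)) : ℝ) := by exact_mod_cast h2'
      simp only [hfdef, hins]
      rw [abs_le]
      constructor <;> linarith
    -- concentration with `s = kk n`, `t = tt n + 1`
    have hprod := hconc (criticalProbI 3) F hFsub f hfm hdet hc1 (kk n) ((tt n : ℝ) + 1)
      (by positivity)
    rw [← hPdef] at hprod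
    -- a.s. the configuration is on the lattice, where `f = g = MinCut(n,2n)`
    have hae : ∀ᵐ ω ∂P, ω ⊆ (zdGraph 3).edgeSet := by
      rw [hPdef, bondPercolation]; exact setBernoulli_ae_subset
    have hfg : ∀ ω, ω ⊆ (zdGraph 3).edgeSet → f ω = (g ω : ℝ) := by
      intro ω hω
      have key : annMinCut n (ω ∩ ↑F) = annMinCut n ω := by
        rw [hFdef]; exact annMinCut_inter_edgesIn hω
      simp only [hfdef, hgdef, key]
    have hset1 : {ω | f ω ≤ (kk n : ℝ)} =ᵐ[P] {ω | annMinCut n ω ≤ kk n} := by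
      filter_upwards [hae] with ω hω
      show (f ω ≤ (kk n : ℝ)) = (annMinCut n ω ≤ (kk n : ℕ))
      rw [hfg ω hω, ← hcoe ω]
      exact propext (by rw [Nat.cast_le, Nat.cast_le])
    have hset2 : {ω | (kk n : ℝ) + ((tt n : ℝ) + 1) ≤ f ω} =ᵐ[P]
        ({ω | annMinCut n ω ≤ (kk n + tt n : ℕ)}ᶜ : Set (BondConfig (Site 3))) := by
      filter_upwards [hae] with ω hω
      show ((kk n : ℝ) + ((tt n : ℝ) + 1) ≤ f ω) = ¬ (annMinCut n ω ≤ ((kk n + tt n : ℕ) : ℕ∞))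
      rw [hfg ω hω, ← hcoe ω, show (kk n : ℝ) + ((tt n : ℝ) + 1) = ((kk n + tt n + 1 : ℕ) : ℝ) by
        push_cast; ring]
      exact propext (by rw [Nat.cast_le, Nat.cast_le]; omega)
    have hmeas' : MeasurableSet {ω | annMinCut n ω ≤ (kk n + tt n : ℕ)} := hmeas _
    rw [measureReal_congr hset1, measureReal_congr hset2, measureReal_compl hmeas', probReal_univ]
      at hprod
    -- abbreviations for the two probabilities
    set pk : ℝ := P.real {ω | annMinCut n ω ≤ kk n} with hpkdef
    set q : ℝ := P.real {ω | annMinCut n ω ≤ (kk n + tt n : ℕ)} with hqdef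
    have hpkpos : 0 < pk := lt_of_lt_of_le (Real.exp_pos _) hfl
    -- size of `F`
    have hFpos : (0 : ℝ) < F.card := by exact_mod_cast card_edgesIn_box_pos hn
    have hFle : (4 : ℝ) * F.card ≤ 3000 * (n : ℝ) ^ 3 := by
      have h1 : ((F.card : ℕ) : ℝ) ≤ ((6 * (4 * n + 1) ^ 3 : ℕ) : ℝ) := by
        exact_mod_cast card_edgesIn_box_le n
      push_cast at h1
      have h2 : (4 * (n : ℝ) + 1) ^ 3 ≤ (5 * (n : ℝ)) ^ 3 :=
        pow_le_pow_left₀ (by positivity) (by linarith) 3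
      have h3 : (5 * (n : ℝ)) ^ 3 = 125 * (n : ℝ) ^ 3 := by ring
      linarith [h1, h2, h3]
    -- `t²` dominates `n^{2θ} = n^γ · n³`
    have htt : (n : ℝ) ^ θ ≤ ((tt n : ℝ) + 1) :=
      (Nat.le_ceil _).trans (le_add_of_nonneg_right zero_le_one)
    have hsq : (n : ℝ) ^ γ * (n : ℝ) ^ 3 ≤ ((tt n : ℝ) + 1) ^ 2 := by
      have h1 : ((n : ℝ) ^ θ) ^ 2 ≤ ((tt n : ℝ) + 1) ^ 2 :=
        pow_le_pow_left₀ (Real.rpow_nonneg hnpos.le _) htt 2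
      have h2 : ((n : ℝ) ^ θ) ^ 2 = (n : ℝ) ^ γ * (n : ℝ) ^ 3 := by
        rw [← Real.rpow_mul_natCast hnpos.le, show (θ * (2 : ℕ) : ℝ) = γ + 3 by push_cast; linarith,
          Real.rpow_add hnpos, show (3 : ℝ) = ((3 : ℕ) : ℝ) by norm_num, Real.rpow_natCast]
      linarith
    have hexp_arg : -(((tt n : ℝ) + 1) ^ 2) / (4 * (F.card : ℝ)) ≤ -((n : ℝ) ^ γ / 3000) := by
      rw [neg_div, neg_le_neg_iff, div_le_div_iff₀ (by norm_num : (0 : ℝ) < 3000) (by linarith)]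
      have hγnn : 0 ≤ (n : ℝ) ^ γ := Real.rpow_nonneg hnpos.le _
      calc (n : ℝ) ^ γ * (4 * (F.card : ℝ)) ≤ (n : ℝ) ^ γ * (3000 * (n : ℝ) ^ 3) :=
            mul_le_mul_of_nonneg_left hFle hγnn
        _ = ((n : ℝ) ^ γ * (n : ℝ) ^ 3) * 3000 := by ring
        _ ≤ ((tt n : ℝ) + 1) ^ 2 * 3000 := by nlinarith [hsq]
    -- `1 - q ≤ exp(-t²/4N) / pk ≤ exp(-n^γ/3000) · exp(n^β) ≤ ε n`
    have h1q : 1 - q ≤ Real.exp (-(((tt n : ℝ) + 1) ^ 2) / (4 * (F.card : ℝ))) / pk := by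
      rw [le_div_iff₀ hpkpos, mul_comm]
      exact hprod
    have h2 : Real.exp (-(((tt n : ℝ) + 1) ^ 2) / (4 * (F.card : ℝ))) / pk ≤
        Real.exp (-((n : ℝ) ^ γ / 3000)) / Real.exp (-((n : ℝ) ^ β)) := by
      have hA : Real.exp (-(((tt n : ℝ) + 1) ^ 2) / (4 * (F.card : ℝ))) ≤
          Real.exp (-((n : ℝ) ^ γ / 3000)) := Real.exp_le_exp.2 hexp_arg
      calc Real.exp (-(((tt n : ℝ) + 1) ^ 2) / (4 * (F.card : ℝ))) / pk
          ≤ Real.exp (-((n : ℝ) ^ γ / 3000)) / pk :=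
            div_le_div_of_nonneg_right hA hpkpos.le
        _ ≤ Real.exp (-((n : ℝ) ^ γ / 3000)) / Real.exp (-((n : ℝ) ^ β)) :=
            div_le_div_of_nonneg_left (Real.exp_pos _).le (Real.exp_pos _) hfl
    have h3 : Real.exp (-((n : ℝ) ^ γ / 3000)) / Real.exp (-((n : ℝ) ^ β)) ≤ ε n := by
      rw [← Real.exp_sub, Real.exp_le_exp]
      have : (n : ℝ) ^ β ≤ (n : ℝ) ^ β' := Real.rpow_le_rpow_of_exponent_le hnR hββ'
      linarith
    linarith [h1q, h2, h3]
  /- `ε n → 0` -/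
  have hε : Tendsto ε atTop (𝓝 0) := by
    have hup : Tendsto (fun n : ℕ => Real.exp (-((n : ℝ) ^ β'))) atTop (𝓝 0) :=
      Real.tendsto_exp_atBot.comp (tendsto_neg_atTop_atBot.comp
        ((tendsto_rpow_atTop hβ'pos).comp tendsto_natCast_atTop_atTop))
    have hgap : ∀ᶠ n : ℕ in atTop, (6000 : ℝ) ≤ (n : ℝ) ^ (γ - β') :=
      ((tendsto_rpow_atTop (sub_pos.2 hγβ)).comp tendsto_natCast_atTop_atTop).eventually_ge_atTop _
    refine tendsto_of_tendsto_of_tendsto_of_le_of_le' tendsto_const_nhds hup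
      (Eventually.of_forall fun n => (Real.exp_pos _).le) ?_
    filter_upwards [hgap, eventually_ge_atTop 1] with n hn hn1
    have hnpos : (0 : ℝ) < n := by exact_mod_cast hn1
    have hsplit : (n : ℝ) ^ γ = (n : ℝ) ^ β' * (n : ℝ) ^ (γ - β') := by
      rw [← Real.rpow_add hnpos]; ring_nf
    have hβnn : 0 ≤ (n : ℝ) ^ β' := Real.rpow_nonneg hnpos.le _
    change Real.exp ((n : ℝ) ^ β' - (n : ℝ) ^ γ / 3000) ≤ Real.exp (-((n : ℝ) ^ β'))
    rw [Real.exp_le_exp, hsplit]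
    nlinarith [mul_le_mul_of_nonneg_left hn hβnn]
  /- the budget `kk n + tt n ≤ n^{2-c'}` eventually -/
  have hbud : ∀ᶠ n : ℕ in atTop, ((kk n + tt n : ℕ) : ℝ) ≤ (n : ℝ) ^ (2 - c') := by
    have hgap : ∀ᶠ n : ℕ in atTop, (3 : ℝ) ≤ (n : ℝ) ^ c' :=
      ((tendsto_rpow_atTop hc'pos).comp tendsto_natCast_atTop_atTop).eventually_ge_atTop _
    filter_upwards [hgap, eventually_ge_atTop 1] with n hn hn1
    have hnR : (1 : ℝ) ≤ n := by exact_mod_cast hn1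
    have hnpos : (0 : ℝ) < n := by linarith
    have hk : ((kk n : ℕ) : ℝ) ≤ (n : ℝ) ^ a :=
      (Nat.floor_le (Real.rpow_nonneg hnpos.le _)).trans (Real.rpow_le_rpow_of_exponent_le hnR hac)
    have ht : ((tt n : ℕ) : ℝ) ≤ (n : ℝ) ^ a + (n : ℝ) ^ a := by
      have h1 : ((tt n : ℕ) : ℝ) < (n : ℝ) ^ θ + 1 := Nat.ceil_lt_add_one (Real.rpow_nonneg hnpos.le _)
      have h2 : (n : ℝ) ^ θ ≤ (n : ℝ) ^ a := Real.rpow_le_rpow_of_exponent_le hnR haθ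
      have h3 : (1 : ℝ) ≤ (n : ℝ) ^ a := Real.one_le_rpow hnR hapos.le
      linarith
    have hana : 0 ≤ (n : ℝ) ^ a := Real.rpow_nonneg hnpos.le _
    have hpow : (n : ℝ) ^ (2 - c') = (n : ℝ) ^ a * (n : ℝ) ^ c' := by
      rw [hbudget, Real.rpow_add hnpos]
    push_cast
    rw [hpow]
    nlinarith [mul_le_mul_of_nonneg_left hn hana]
  /- conclusion: squeeze between `1 - ε n → 1` and `1` -/
  have hlow : Tendsto (fun n : ℕ => 1 - ε n) atTop (𝓝 1) := by
    simpa using (tendsto_const_nhds (x := (1 : ℝ))).sub hε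
  refine tendsto_of_tendsto_of_tendsto_of_le_of_le' hlow tendsto_const_nhds ?_
    (Eventually.of_forall fun n => measureReal_le_one)
  filter_upwards [hfloor, hbud, eventually_ge_atTop 1] with n hfl hb hn1
  calc 1 - ε n ≤ P.real {ω | annMinCut n ω ≤ (kk n + tt n : ℕ)} := hmain n hn1 hfl
    _ ≤ P.real {ω | ∃ S : Finset (Sym2 (Site 3)), (S.card : ℝ) ≤ (n : ℝ) ^ (2 - c') ∧
          ¬ ∃ x ∈ box 3 n, ∃ y ∈ innerBoundary (zdGraph 3) (box 3 (2 * n)),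
            (ω \ ↑S) ∈ openConnIn (↑(box 3 (2 * n)) : Set (Site 3)) x y} :=
        measureReal_mono (hevent n hb)

/-- **The skeleton IS the crux proof** (D-0027 §3.3): `DefectDimension` from the two registered stubs;
sorry-free as soon as `stub_concentration` and `stub_rareCheapCut` are discharged. -/
theorem DefectDimension_proof :
    Summit.CriticalPhenomena.PercolationContinuityZ3.Theses.PercBudgetLadder.DefectDimension :=
  DefectDimension_of stub_concentration stub_rareCheapCut

end Summit.CriticalPhenomena.PercolationContinuityZ3.Cruxes.DefectDimension.TalagrandWindowAmplifier

end
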